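import Mathlib
import HarnessLib
import Literature.MathematicalPhysics.QuantumFieldTheory.ConstructiveQFTWave0
import Summits.Ventures.LatticeQCDFlow.Scaling.ThinSectorsConnected
import Summits.Ventures.LatticeQCDFlow.Scaling.TorusCochain

/-!
# The integer Poincaré lemma in degree two on the discrete `d`-torus, with periods

HONEST FRAMING: exact (Metropolis-corrected) sampling algorithms for lattice gauge theory;
figures of merit are autocorrelation/cost numbers at stated couplings and volumes; no
continuum-physics claim.

Venture `LatticeQCDFlow` (cell pub-lqcd), topic `Scaling`, FANOUT row 29 (theory2, gen-23), item 112b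
(after 112a `Scaling/TorusCochain`).  NEW WORK over Mathlib and item 112a; nothing is cited as a fact.
LITERATURE STATUS (honest): `H²(T^d; ℤ) ≅ ℤ^{d(d−1)/2}` generated by the coordinate `2`-tori, torsion
free, is textbook; the statement below is its cochain-level form on the cubical `(ℤ/L)^d` and the
only content is an explicit primitive.  In lattice gauge theory this is the step "the Dirac sheet of a
compact `U(1)` field with prescribed monopole numbers and fluxes is determined up to a gauge/lift
ambiguity" (DeGrand–Toussaint 1980; [Luscher1999AbelianChiral, §7]).  Grade: formalisation of known
mathematics.  Item 110 `ThinSectors.exists_curl_eq` is the case `d = 2`.  RELATION TO THE TREE: the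
Literature file `QuantumFieldTheory/AbelianTorusCochains` has the same torus coboundaries in curried
form (`LatticeForm.td₁ = curl`, `LatticeForm.td₂` = `cob` up to sign and ordering; both after
[ForsstromLenellsViklund2022, §2.3.2]) and exactness for closed `2`-cochains of SMALL SUPPORT away from
the seam (`exists_td₁_eq_of_liftBox`, `d ≥ 3`, via the `ℤ^d` lemma of `CubicalCochains`); the GLOBAL
statement below (arbitrary support, period conditions, every `d`) is not there and is what C10 needs.

THE STATEMENT (`exists_curl_eq`, coefficients in any additive commutative group `A`, every `d`,
every `L ≥ 1`).  For a `2`-cochain `G : Site d L → Fin d → Fin d → A` write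
`curl c (x; μ,ν) = c(x,μ) + c(x+μ̂,ν) − c(x+ν̂,μ) − c(x,ν)` (the additive plaquette),
`cob G (x; ν,ρ,σ) = Δ_ν G_{ρσ} + Δ_ρ G_{σν} + Δ_σ G_{νρ}` (the cube coboundary in the cyclic form of the
tree's cube identity `plaquetteHolonomy_cube`) and `period G (x; μ,ν) = Σ_{s,t} G(x|_{μ:=s, ν:=t}; μ,ν)`
(the sum over the coordinate `(μ,ν)`-torus through `x`).  IF `G` is antisymmetric with zero diagonal,
`cob G ≡ 0` and `period G ≡ 0`, THEN `G = curl c` for some `c : Edge d L → A`.  (All three hypotheses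
are necessary: `curl c` has each of the properties — `curl_swap`, `curl_self`, `cob_curl`,
`period_curl`.)

PROOF (`kill_two`, iterated by `exists_curl_eq_aux` over a cut-off; no induction on `d`).  Fix
`κ`.  The `κ`-circle sums `W_ν = Σ_{κ-circle} G_{κν}` form a closed `1`-cochain (112a) whose circle sums are
periods of `G`, hence vanish, so `W = grad φ`; with `c(x,ν) = pSum_κ G_{κν}` (`ν ≠ κ`) and
`c(x,κ) = −φ(x)` on the last `κ`-link of each circle, `G − curl c` has no `(κ,ν)` components
(telescoping plus the dumped circle sum cancelled by `grad φ`), and killed directions stay killed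
(`cob G = 0` transports `G_{μ·} ≡ 0` along `κ`).  For antisymmetric cochains `cob` is
alternating (`cob_swap12/23`, degenerate triples vanish), so closedness and the period condition
need only be checked on increasing tuples (`cob_eq_zero_of_sorted`, `period_eq_zero_of_sorted`);
periods of closed cochains do not depend on the base point (`period_eq_period`); `period_eq_sum`
(the `x + s μ̂ + t ν̂` parametrisation of the tree's `magneticFlux`); `period_swap_of_anti`.

No `sorry`, no new axioms, no `opaque`; standard axioms only.
-/

noncomputable section

namespace Summit.Ventures.LatticeQCDFlow.Theory2.Lattice.Flux.TorusCochain

open Finset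
open Literature.MathematicalPhysics.QuantumFieldTheory

variable {d L : ℕ} {A : Type*} [AddCommGroup A]

/-! ## §1. The lattice curl and the cube coboundary; antisymmetric cochains -/

/-- The lattice curl (plaquette coboundary) of a `1`-cochain:
`(dc)(x; μ, ν) = c(x,μ) + c(x+μ̂,ν) − c(x+ν̂,μ) − c(x,ν)` — the additive form of the plaquette
holonomy. [folklore] -/
def curl (c : Edge d L → A) (x : Site d L) (μ ν : Fin d) : A :=
  c (x, μ) + c (x.shift μ, ν) - c (x.shift ν, μ) - c (x, ν)

/-- The cube coboundary of a `2`-cochain, in the cyclic form of the cube identity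
`plaquetteHolonomy_cube`: `(dG)(x; ν, ρ, σ) = Δ_ν G_{ρσ} + Δ_ρ G_{σν} + Δ_σ G_{νρ}`. [folklore] -/
def cob (G : Site d L → Fin d → Fin d → A) (x : Site d L) (ν ρ σ : Fin d) : A :=
  G (x.shift ν) ρ σ - G x ρ σ + (G (x.shift ρ) σ ν - G x σ ν) + (G (x.shift σ) ν ρ - G x ν ρ)

/-- The curl is antisymmetric. [folklore] -/
theorem curl_swap (c : Edge d L → A) (x : Site d L) (μ ν : Fin d) : curl c x ν μ = -curl c x μ ν := by
  simp only [curl]; abel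

/-- The curl has zero diagonal. [folklore] -/
theorem curl_self (c : Edge d L → A) (x : Site d L) (μ : Fin d) : curl c x μ μ = 0 := by
  simp only [curl]; abel

/-- The curl is additive (difference form). [folklore] -/
theorem curl_sub (c c' : Edge d L → A) (x : Site d L) (μ ν : Fin d) :
    curl (fun e => c e - c' e) x μ ν = curl c x μ ν - curl c' x μ ν := by
  simp only [curl]; abel

/-- The curl is additive. [folklore] -/
theorem curl_add (c c' : Edge d L → A) (x : Site d L) (μ ν : Fin d) :
    curl (fun e => c e + c' e) x μ ν = curl c x μ ν + curl c' x μ ν := by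
  simp only [curl]; abel

/-- **`d² = 0`**: the cube coboundary of a curl vanishes (every edge of the cube occurs once with
each orientation). [folklore] -/
theorem cob_curl (c : Edge d L → A) (x : Site d L) (ν ρ σ : Fin d) : cob (curl c) x ν ρ σ = 0 := by
  simp only [cob, curl, Site.shift_shift_comm x ρ ν, Site.shift_shift_comm x σ ν,
    Site.shift_shift_comm x σ ρ]
  abel

/-- The cube coboundary is additive (difference form). [folklore] -/
theorem cob_sub (G G' : Site d L → Fin d → Fin d → A) (x : Site d L) (ν ρ σ : Fin d) :
    cob (fun y α β => G y α β - G' y α β) x ν ρ σ = cob G x ν ρ σ - cob G' x ν ρ σ := by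
  simp only [cob]; abel

/-- The cube coboundary of an antisymmetric cochain is odd under swapping the first two indices.
[folklore] -/
theorem cob_swap12 (G : Site d L → Fin d → Fin d → A) (hanti : ∀ x μ ν, G x ν μ = -G x μ ν)
    (x : Site d L) (ν ρ σ : Fin d) : cob G x ρ ν σ = -cob G x ν ρ σ := by
  simp only [cob]
  rw [hanti (x.shift ρ) σ ν, hanti x σ ν, hanti (x.shift ν) ρ σ, hanti x ρ σ, hanti (x.shift σ) ν ρ,
    hanti x ν ρ]
  abel

/-- The cube coboundary of an antisymmetric cochain is odd under swapping the last two indices.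
[folklore] -/
theorem cob_swap23 (G : Site d L → Fin d → Fin d → A) (hanti : ∀ x μ ν, G x ν μ = -G x μ ν)
    (x : Site d L) (ν ρ σ : Fin d) : cob G x ν σ ρ = -cob G x ν ρ σ := by
  simp only [cob]
  rw [hanti (x.shift ν) ρ σ, hanti x ρ σ, hanti (x.shift σ) ν ρ, hanti x ν ρ, hanti (x.shift ρ) σ ν,
    hanti x σ ν]
  abel

/-- Degenerate cube coboundaries vanish (first two indices equal). [folklore] -/
theorem cob_self12 (G : Site d L → Fin d → Fin d → A) (hanti : ∀ x μ ν, G x ν μ = -G x μ ν)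
    (hdiag : ∀ x μ, G x μ μ = 0) (x : Site d L) (ν σ : Fin d) : cob G x ν ν σ = 0 := by
  simp only [cob, hdiag, sub_zero, add_zero]
  rw [hanti (x.shift ν) ν σ, hanti x ν σ]
  abel

/-- Degenerate cube coboundaries vanish (last two indices equal). [folklore] -/
theorem cob_self23 (G : Site d L → Fin d → Fin d → A) (hanti : ∀ x μ ν, G x ν μ = -G x μ ν)
    (hdiag : ∀ x μ, G x μ μ = 0) (x : Site d L) (ν ρ : Fin d) : cob G x ν ρ ρ = 0 := by
  simp only [cob, hdiag, sub_zero, zero_add]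
  rw [hanti (x.shift ρ) ν ρ, hanti x ν ρ]
  abel

/-- Degenerate cube coboundaries vanish (outer indices equal). [folklore] -/
theorem cob_self13 (G : Site d L → Fin d → Fin d → A) (hanti : ∀ x μ ν, G x ν μ = -G x μ ν)
    (hdiag : ∀ x μ, G x μ μ = 0) (x : Site d L) (ν ρ : Fin d) : cob G x ν ρ ν = 0 := by
  simp only [cob, hdiag, sub_zero]
  rw [hanti (x.shift ν) ν ρ, hanti x ν ρ]
  abel

/-- **Closedness of an antisymmetric `2`-cochain need only be checked on increasing triples.**
[folklore] -/
theorem cob_eq_zero_of_sorted (G : Site d L → Fin d → Fin d → A)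
    (hanti : ∀ x μ ν, G x ν μ = -G x μ ν) (hdiag : ∀ x μ, G x μ μ = 0)
    (h : ∀ x ν ρ σ, ν < ρ → ρ < σ → cob G x ν ρ σ = 0) (x : Site d L) (ν ρ σ : Fin d) :
    cob G x ν ρ σ = 0 := by
  rcases lt_trichotomy ν ρ with h1 | rfl | h1
  · rcases lt_trichotomy ρ σ with h2 | rfl | h2
    · exact h x ν ρ σ h1 h2
    · exact cob_self23 G hanti hdiag x ν ρ
    · rcases lt_trichotomy ν σ with h3 | rfl | h3
      · rw [cob_swap23 G hanti x ν σ ρ, h x ν σ ρ h3 h2, neg_zero]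
      · exact cob_self13 G hanti hdiag x ν ρ
      · rw [cob_swap23 G hanti x ν σ ρ, cob_swap12 G hanti x σ ν ρ, neg_neg]
        exact h x σ ν ρ h3 h1
  · exact cob_self12 G hanti hdiag x ν σ
  · rcases lt_trichotomy ν σ with h3 | rfl | h3
    · rw [cob_swap12 G hanti x ρ ν σ, h x ρ ν σ h1 h3, neg_zero]
    · exact cob_self13 G hanti hdiag x ν ρ
    · rcases lt_trichotomy ρ σ with h4 | rfl | h4
      · rw [cob_swap12 G hanti x ρ ν σ, cob_swap23 G hanti x ρ σ ν, neg_neg]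
        exact h x ρ σ ν h4 h3
      · exact cob_self23 G hanti hdiag x ν ρ
      · rw [cob_swap23 G hanti x ν σ ρ, cob_swap12 G hanti x σ ν ρ, cob_swap23 G hanti x σ ρ ν,
          neg_neg, h x σ ρ ν h4 h1, neg_zero]

/-! ## §2. Periods, and the degree-two Poincaré lemma -/

variable [NeZero L]

/-- The period of a `2`-cochain through the `(μ, ν)`-plane through `x`. [folklore] -/
def period (G : Site d L → Fin d → Fin d → A) (x : Site d L) (μ ν : Fin d) : A :=
  lineSum μ (lineSum ν (fun y => G y μ ν)) x

/-- Periods are additive (difference form). [folklore] -/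
theorem period_sub (G G' : Site d L → Fin d → Fin d → A) (x : Site d L) (μ ν : Fin d) :
    period (fun y α β => G y α β - G' y α β) x μ ν = period G x μ ν - period G' x μ ν := by
  have h : lineSum ν (fun y => G y μ ν - G' y μ ν) =
      fun z => lineSum ν (fun y => G y μ ν) z - lineSum ν (fun y => G' y μ ν) z :=
    funext fun z => lineSum_sub ν _ _ z
  rw [period, h, lineSum_sub, period, period]

/-- **`d² = 0` for periods**: the periods of a curl vanish (at every base point). [folklore] -/
theorem period_curl (c : Edge d L → A) (x : Site d L) (μ ν : Fin d) : period (curl c) x μ ν = 0 := by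
  by_cases hμν : μ = ν
  · subst hμν
    simp only [period, curl_self, lineSum, Finset.sum_const_zero]
  obtain ⟨g, hg⟩ : ∃ g : Site d L → A, ∀ z, g z = c (z, μ) := ⟨_, fun _ => rfl⟩
  obtain ⟨h, hh⟩ : ∃ h : Site d L → A, ∀ z, h z = c (z, ν) := ⟨_, fun _ => rfl⟩
  have e1 : (fun y => curl c y μ ν) = fun y => (h (y.shift μ) - h y) - (g (y.shift ν) - g y) := by
    funext y; simp only [curl, hg, hh]; abel
  have e2 : lineSum ν (fun y => (h (y.shift μ) - h y) - (g (y.shift ν) - g y)) =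
      fun w => lineSum ν h (w.shift μ) - lineSum ν h w := by
    funext w
    rw [lineSum_sub, lineSum_shift_sub_self, sub_zero, lineSum_sub, lineSum_shift_of_ne hμν]
  rw [period, e1, e2, lineSum_shift_sub_self]

/-- **Killing one direction, degree two.**  For an antisymmetric closed `2`-cochain with vanishing
periods, subtracting the curl of an explicit `1`-cochain (partial sums along `κ` in the transverse
components, the primitive of the `κ`-line sums on the last `κ`-links) kills every `(κ, ν)`
component and keeps killed directions killed. [folklore] -/
theorem kill_two (κ : Fin d) (G : Site d L → Fin d → Fin d → A)
    (hanti : ∀ x μ ν, G x ν μ = -G x μ ν) (hdiag : ∀ x μ, G x μ μ = 0)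
    (hcob : ∀ x ν ρ σ, cob G x ν ρ σ = 0) (hper : ∀ x μ ν, period G x μ ν = 0) :
    ∃ c : Edge d L → A, (∀ x ν, G x κ ν - curl c x κ ν = 0) ∧
      ∀ μ, (∀ x ν, G x μ ν = 0) → ∀ x ν, G x μ ν - curl c x μ ν = 0 := by
  -- the `κ`-line sums of the `(κ, ν)` components form a closed `1`-cochain with zero circle sums
  set W : Site d L → Fin d → A := fun x ν => lineSum κ (fun y => G y κ ν) x with hW
  have hWκ : ∀ x, W x κ = 0 := fun x => by
    simp only [hW, hdiag, lineSum, Finset.sum_const_zero]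
  have hWc : ∀ x ν ρ, W (x.shift ν) ρ - W x ρ = W (x.shift ρ) ν - W x ν := by
    intro x ν ρ
    by_cases hνκ : ν = κ
    · subst hνκ
      rw [hWκ, hWκ, sub_zero]
      simp only [hW, lineSum_shift_self, sub_self]
    by_cases hρκ : ρ = κ
    · subst hρκ
      rw [hWκ, hWκ, sub_zero]
      simp only [hW, lineSum_shift_self, sub_self]
    obtain ⟨P, hP⟩ : ∃ P : Site d L → A, ∀ z, P z = G z ν ρ := ⟨_, fun _ => rfl⟩
    have key : ∀ y, G (y.shift ν) κ ρ - G y κ ρ =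
        (P (y.shift κ) - P y) + (G (y.shift ρ) κ ν - G y κ ν) := by
      intro y
      have h1 := hcob y κ ν ρ
      rw [← sub_eq_zero, ← neg_eq_zero, ← h1]
      simp only [cob, hanti (y.shift ν) κ ρ, hanti y κ ρ, hP]
      abel
    simp only [hW]
    rw [lineSum_shift_of_ne hνκ, lineSum_shift_of_ne hρκ, ← lineSum_sub, ← lineSum_sub]
    simp only [key]
    rw [lineSum_add, lineSum_shift_sub_self, zero_add]
  have hWl : ∀ x ν, lineSum ν (fun y => W y ν) x = 0 := by
    intro x ν
    by_cases hνκ : ν = κ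
    · subst hνκ
      simp only [hWκ, lineSum, Finset.sum_const_zero]
    have h := hper x κ ν
    simp only [period, lineSum] at h
    simp only [hW, lineSum]
    rw [Finset.sum_comm]
    simp only [Function.update_comm hνκ]
    exact h
  obtain ⟨φ, hφ⟩ := exists_grad_eq W hWc hWl
  -- the correcting `1`-cochain
  set c : Edge d L → A := fun e =>
    if e.2 = κ then (if (e.1 κ).val + 1 = L then -φ e.1 else 0)
    else pSum κ (fun y => G y κ e.2) e.1 with hc
  have hcκ : ∀ z, c (z, κ) = if (z κ).val + 1 = L then -φ z else 0 := fun z => by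
    simp only [hc, if_true]
  have hcν : ∀ z ν, ν ≠ κ → c (z, ν) = pSum κ (fun y => G y κ ν) z := fun z ν hν => by
    simp only [hc, if_neg hν]
  -- the `(κ, ν)` components are killed
  have hmain : ∀ x ν, G x κ ν - curl c x κ ν = 0 := by
    intro x ν
    by_cases hνκ : ν = κ
    · subst hνκ; rw [curl_self, hdiag, sub_zero]
    have hP : pSum κ (fun y => G y κ ν) (x.shift κ) =
        (G x κ ν - if (x κ).val + 1 = L then W x ν else 0) + pSum κ (fun y => G y κ ν) x :=
      sub_eq_iff_eq_add.mp (pSum_shift_self_sub κ _ x)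
    have hφ' : φ (x.shift ν) = W x ν + φ x := sub_eq_iff_eq_add.mp (hφ x ν)
    rw [curl, hcκ, hcκ, hcν _ _ hνκ, hcν _ _ hνκ, shift_apply_of_ne x (Ne.symm hνκ), hP, hφ']
    by_cases hx : (x κ).val + 1 = L
    · simp only [if_pos hx]; abel
    · simp only [if_neg hx]; abel
  refine ⟨c, hmain, fun μ hμ x ν => ?_⟩
  -- killed directions stay killed
  by_cases hμκ : μ = κ
  · subst hμκ; exact hmain x ν
  have hGκμ : ∀ y, G y κ μ = 0 := fun y => by rw [hanti, hμ, neg_zero]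
  have hcμ : ∀ z, c (z, μ) = 0 := fun z => by
    rw [hcν _ _ hμκ]
    simp only [hGκμ, pSum, Finset.sum_const_zero]
  rw [hμ, zero_sub, neg_eq_zero, curl, hcμ, hcμ, zero_add, sub_zero]
  by_cases hνκ : ν = κ
  · subst hνκ
    have hWμ : W x μ = 0 := by simp only [hW, hGκμ, lineSum, Finset.sum_const_zero]
    have hφ' : φ (x.shift μ) = φ x := by
      have h := hφ x μ; rw [grad, hWμ, sub_eq_zero] at h; exact h
    rw [hcκ, hcκ, shift_apply_of_ne x (Ne.symm hμκ), hφ', sub_self]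
  · have key : ∀ y, G (y.shift μ) κ ν - G y κ ν = 0 := fun y => by
      have h1 := hcob y μ κ ν
      simp only [cob, hanti (y.shift κ) μ ν, hanti y μ ν, hμ, neg_zero, sub_zero, add_zero] at h1
      exact h1
    rw [hcν _ _ hνκ, hcν _ _ hνκ, pSum_shift_of_ne hμκ, ← pSum_sub]
    simp only [key, pSum, Finset.sum_const_zero]

/-- The iteration behind the degree-two lemma. [folklore] -/
theorem exists_curl_eq_aux :
    ∀ n : ℕ, ∀ G : Site d L → Fin d → Fin d → A,
      (∀ x μ ν, G x ν μ = -G x μ ν) → (∀ x μ, G x μ μ = 0) → (∀ x ν ρ σ, cob G x ν ρ σ = 0) →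
      (∀ x μ ν, period G x μ ν = 0) → (∀ x (μ ν : Fin d), n ≤ μ.val → G x μ ν = 0) →
      ∃ c : Edge d L → A, ∀ x μ ν, curl c x μ ν = G x μ ν := by
  intro n
  induction n with
  | zero =>
    intro G _ _ _ _ hk
    exact ⟨fun _ => 0, fun x μ ν => by rw [hk x μ ν (Nat.zero_le _)]; simp [curl]⟩
  | succ n ih =>
    intro G hanti hdiag hcob hper hk
    by_cases hn : n < d
    · obtain ⟨c, hcκ, hcμ⟩ := kill_two ⟨n, hn⟩ G hanti hdiag hcob hper
      obtain ⟨c', hc'⟩ := ih (fun x μ ν => G x μ ν - curl c x μ ν)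
        (fun x μ ν => by rw [hanti, curl_swap]; abel)
        (fun x μ => by rw [hdiag, curl_self, sub_zero])
        (fun x ν ρ σ => by rw [cob_sub, hcob, cob_curl, sub_zero])
        (fun x μ ν => by rw [period_sub, hper, period_curl, sub_zero])
        (fun x μ ν hμ => by
          by_cases hμn : μ.val = n
          · have : μ = ⟨n, hn⟩ := Fin.ext hμn
            subst this; exact hcκ x ν
          · exact hcμ μ (fun y ν' => hk y μ ν' (by omega)) x ν)
      exact ⟨fun e => c' e + c e, fun x μ ν => by rw [curl_add, hc']; abel⟩
    · exact ih G hanti hdiag hcob hper (fun x μ ν hμ => by have := μ.isLt; omega)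

/-- **Integer Poincaré lemma on the discrete torus, degree two.**  An antisymmetric `2`-cochain on
`(ℤ/L)^d` (values in any abelian group) which is closed (`cob G = 0`) and all of whose periods
vanish is the curl of a `1`-cochain. [folklore] -/
theorem exists_curl_eq (G : Site d L → Fin d → Fin d → A)
    (hanti : ∀ x μ ν, G x ν μ = -G x μ ν) (hdiag : ∀ x μ, G x μ μ = 0)
    (hcob : ∀ x ν ρ σ, cob G x ν ρ σ = 0) (hper : ∀ x μ ν, period G x μ ν = 0) :
    ∃ c : Edge d L → A, ∀ x μ ν, curl c x μ ν = G x μ ν :=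
  exists_curl_eq_aux d G hanti hdiag hcob hper (fun _ μ _ hμ => absurd μ.isLt (not_lt.mpr hμ))

/-! ## §3. Base-point independence and the reductions for periods -/

/-- **Periods of a closed `2`-cochain are shift-invariant.** [folklore] -/
theorem period_shift (G : Site d L → Fin d → Fin d → A) (hdiag : ∀ x μ, G x μ μ = 0)
    (hcob : ∀ x ν ρ σ, cob G x ν ρ σ = 0) (x : Site d L) (μ ν ρ : Fin d) :
    period G (x.shift ρ) μ ν = period G x μ ν := by
  by_cases hμν : μ = ν
  · subst hμν
    simp only [period, hdiag, lineSum, Finset.sum_const_zero]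
  by_cases hρμ : ρ = μ
  · subst hρμ; rw [period, lineSum_shift_self, period]
  by_cases hρν : ρ = ν
  · subst hρν
    rw [period, lineSum_shift_of_ne hρμ, period]
    simp only [lineSum_shift_self]
  rw [← sub_eq_zero, period, period, lineSum_shift_of_ne hρμ, ← lineSum_sub]
  have e1 : (fun y => lineSum ν (fun y => G y μ ν) (y.shift ρ) - lineSum ν (fun y => G y μ ν) y) =
      fun w => lineSum ν (fun y => G (y.shift ρ) μ ν - G y μ ν) w := by
    funext w; rw [lineSum_shift_of_ne hρν, lineSum_sub]
  obtain ⟨P, hP⟩ : ∃ P : Site d L → A, ∀ z, P z = G z ν ρ := ⟨_, fun _ => rfl⟩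
  obtain ⟨Q, hQ⟩ : ∃ Q : Site d L → A, ∀ z, Q z = G z ρ μ := ⟨_, fun _ => rfl⟩
  have key : ∀ y, G (y.shift ρ) μ ν - G y μ ν = -(P (y.shift μ) - P y) - (Q (y.shift ν) - Q y) := by
    intro y
    have h1 := hcob y ρ μ ν
    rw [← sub_eq_zero, ← h1]
    simp only [cob, hP, hQ]
    abel
  have e2 : (fun w => lineSum ν (fun y => G (y.shift ρ) μ ν - G y μ ν) w) =
      fun w => -(lineSum ν P (w.shift μ) - lineSum ν P w) := by
    funext w
    simp only [key]
    rw [lineSum_sub, lineSum_shift_sub_self, sub_zero, lineSum_neg, lineSum_sub,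
      lineSum_shift_of_ne hμν P]
  rw [e1, e2, lineSum_neg, neg_eq_zero]
  exact lineSum_shift_sub_self μ (lineSum ν P) x

/-- **Periods of a closed `2`-cochain do not depend on the base point.** [folklore] -/
theorem period_eq_period (G : Site d L → Fin d → Fin d → A) (hdiag : ∀ x μ, G x μ μ = 0)
    (hcob : ∀ x ν ρ σ, cob G x ν ρ σ = 0) (x y : Site d L) (μ ν : Fin d) :
    period G x μ ν = period G y μ ν :=
  eq_of_forall_shift (fun z => period G z μ ν) (fun z ρ => period_shift G hdiag hcob z μ ν ρ) x y

/-- Periods as plane sums over `x + s μ̂ + t ν̂` (the parametrisation of `magneticFlux`). [folklore] -/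
theorem period_eq_sum (G : Site d L → Fin d → Fin d → A) (x : Site d L) (μ ν : Fin d) :
    period G x μ ν = ∑ s : ZMod L, ∑ t : ZMod L, G (x + Pi.single μ s + Pi.single ν t) μ ν := by
  rw [period, lineSum_eq_sum_add_single]
  exact Finset.sum_congr rfl fun s _ => lineSum_eq_sum_add_single ν _ _

/-- The periods of an antisymmetric `2`-cochain are antisymmetric. [folklore] -/
theorem period_swap_of_anti (G : Site d L → Fin d → Fin d → A) (hanti : ∀ x μ ν, G x ν μ = -G x μ ν)
    (x : Site d L) (μ ν : Fin d) : period G x ν μ = -period G x μ ν := by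
  rw [period_eq_sum, period_eq_sum, Finset.sum_comm, ← Finset.sum_neg_distrib]
  refine Finset.sum_congr rfl fun t _ => ?_
  rw [← Finset.sum_neg_distrib]
  refine Finset.sum_congr rfl fun s _ => ?_
  rw [hanti, add_right_comm x (Pi.single ν s) (Pi.single μ t)]

/-- **Vanishing of the periods of an antisymmetric `2`-cochain need only be checked on increasing
pairs.** [folklore] -/
theorem period_eq_zero_of_sorted (G : Site d L → Fin d → Fin d → A)
    (hanti : ∀ x μ ν, G x ν μ = -G x μ ν) (hdiag : ∀ x μ, G x μ μ = 0)
    (h : ∀ x μ ν, μ < ν → period G x μ ν = 0) (x : Site d L) (μ ν : Fin d) : period G x μ ν = 0 := by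
  rcases lt_trichotomy μ ν with h1 | rfl | h1
  · exact h x μ ν h1
  · simp [period, lineSum, hdiag]
  · rw [period_swap_of_anti G hanti x ν μ, h x ν μ h1, neg_zero]

end Summit.Ventures.LatticeQCDFlow.Theory2.Lattice.Flux.TorusCochain

end
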